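import Mathlib
import Literature.Geometry.Symplectic.JHolomorphicMap
import Literature.Geometry.Symplectic.JHolomorphicRegularityHolderCutoff
import Literature.Geometry.Symplectic.JHolomorphicRegularityHolderLinear
import Literature.Geometry.Symplectic.JHolomorphicRegularityHolderFrame
import HarnessLib

/-!
# Elliptic regularity for `J`-holomorphic curves: Hölder bootstrapping

**Theorem** (McDuff–Salamon 2012, Thm. B.4.1, Hölder version). Let `J` be a `C^∞` almost
complex structure on `ℝ⁴` (`J_x² = -1`) and `u : ℂ → ℝ⁴` a `C¹` map which is `J`-holomorphic
(`du ∘ i = J(u) ∘ du`, `Literature.Geometry.Symplectic.IsJHolomorphicFlat`) and whose derivative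
is locally `r`-Hölder, `0 < r < 1`. Then `u` is `C^∞`
(`contDiff_of_isJHolomorphicFlat_of_holder`). The `C^{1,r}` estimate for the Cauchy transform on
`ℂ²`-valued densities (`Literature.Analysis.Complex.CauchyTransformHolderApriori (ℂ × ℂ) r`,
Vekua 1962, Thm. 1.32) is taken as a hypothesis.

Proof. Flatness gives the first-order system `∂ₓ u + A ∂_y u = 0` with `A = J ∘ u`, whose
coefficients are linear complex structures of the same local Hölder class as `u`. By induction on
`m ≥ 1`, for the LINEAR system `∂ₓ v + A ∂_y v = f` with `A, f` of local class `C^{m,r}` and `v` of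
local class `C^{1,r}`, `v` is of local class `C^{m+1,r}` (`locHolder_succ_of_linearCR`).

* The case `m = 1` is the DIFFERENCE-QUOTIENT STEP `locHolder_two_of_linearCR` (gain of one
  derivative): the difference quotients `v_h = h⁻¹ (v(· + h e) - v)` in a unit direction
  `e ∈ {1, i}` solve `∂ₓ v_h + A ∂_y v_h = f_h` with
  `f_h = h⁻¹ (f(· + h e) - f) - h⁻¹ (A(· + h e) - A) ∂_y v(· + h e)` (`diffQuot_equation`),
  uniformly bounded in `C^{0,r}` together with `v_h`; the linear estimate
  `Literature.Geometry.Symplectic.holder_fderiv_of_linearCR` (conjugation of `A` to `i` by the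
  `C^{1,r}` frame of `Literature.Geometry.Symplectic.exists_linearCR_frame`, Cauchy–Pompeiu and
  the Cauchy transform estimate) bounds `D v_h` uniformly in `C^{0,r}` on a small disc,
  `v_h → ∂_e v` uniformly, so `∂_e v` is `C¹` with Hölder derivative there
  (`differentiableAt_of_holder_approx`), and the two partial derivatives assemble to the local
  class `C^{2,r}` (`locHolder_succ_of_fderiv`).
* The induction step differentiates the equation — `∂_e v` solves the same system with
  right-hand side `∂_e f - (∂_e A) ∂_y v` (`linearCR_fderiv_apply`) — and assembles the two
  partial derivatives again.

Applied to `v = u`, `f = 0`, `A = J ∘ u` this raises the local Hölder class of `u` indefinitely,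
so `u ∈ C^∞`.

## References

* D. McDuff, D. Salamon, *J-holomorphic curves and symplectic topology*, 2nd ed. (2012),
  App. B.4, Thm. B.4.1 (elliptic bootstrapping). [McDuffSalamon2012]
* I. N. Vekua, *Generalized Analytic Functions* (1962), Ch. I, Thm. 1.32.
-/

noncomputable section

open Set Metric Filter Function Complex
open scoped Topology NNReal ContDiff

namespace Literature.Geometry.Symplectic

open Literature.Analysis.Complex Literature.Analysis.FunctionSpaces

/-- Local notation for the model space `ℝ⁴`. -/
local notation "E4" => EuclideanSpace ℝ (Fin 4)

/-- **The equation of the difference quotients.** If `∂ₓ V + A' ∂_y V = F` at `z` and at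
`z + h e`, then `v_h = h⁻¹ (V(· + h e) - V)` satisfies at `z`
`∂ₓ v_h + A' z ∂_y v_h = h⁻¹ (F (z + h e) - F z) - h⁻¹ (A' (z + h e) - A' z) (∂_y V (z + h e))`.
[folklore] -/
theorem diffQuot_equation {A' : ℂ → E4 →L[ℝ] E4} {V F : ℂ → E4} (hV : Differentiable ℝ V)
    {h : ℝ} {e z : ℂ}
    (h₁ : fderiv ℝ V z 1 + A' z (fderiv ℝ V z I) = F z)
    (h₂ : fderiv ℝ V (z + h • e) 1 + A' (z + h • e) (fderiv ℝ V (z + h • e) I) = F (z + h • e)) :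
    fderiv ℝ (fun x => h⁻¹ • (V (x + h • e) - V x)) z 1 +
        A' z (fderiv ℝ (fun x => h⁻¹ • (V (x + h • e) - V x)) z I) =
      h⁻¹ • (F (z + h • e) - F z) -
        (h⁻¹ • (A' (z + h • e) - A' z)) (fderiv ℝ V (z + h • e) I) := by
  have hsh : DifferentiableAt ℝ (fun x => V (x + h • e)) z :=
    (hV _).comp z (differentiableAt_id.add (differentiableAt_const _))
  have hd : DifferentiableAt ℝ (fun x => V (x + h • e) - V x) z := hsh.sub (hV z)
  have hD : fderiv ℝ (fun x => h⁻¹ • (V (x + h • e) - V x)) z =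
      h⁻¹ • (fderiv ℝ V (z + h • e) - fderiv ℝ V z) := by
    rw [fderiv_fun_const_smul hd, fderiv_fun_sub hsh (hV z), fderiv_comp_add_right]
  rw [hD]
  simp only [smul_apply, sub_apply]
  rw [eq_sub_of_add_eq h₁, eq_sub_of_add_eq h₂]
  simp only [map_smul, map_sub, smul_sub]
  abel

-- a long argument: twice the default heartbeat budget
set_option maxHeartbeats 400000 in
/-- **The difference-quotient step (gain of one derivative).** Let `0 < r < 1`, assume the
`C^{1,r}` estimate for the Cauchy transform on `ℂ²`-valued densities, let `A(z)` be linear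
complex structures on `ℝ⁴` (`A(z)² = -1`), and let `A`, `v`, `f` be of local class `C^{1,r}`
near `z₀` with `∂ₓ v + A ∂_y v = f` near `z₀`. Then `v` is of local class `C^{2,r}` near `z₀`.
[cite: McDuffSalamon2012, Thm B.4.1] -/
theorem locHolder_two_of_linearCR {r : ℝ≥0} (hr : 0 < r) (hr1 : r < 1)
    (hT : CauchyTransformHolderApriori (ℂ × ℂ) r) {A : ℂ → E4 →L[ℝ] E4}
    (hA2 : ∀ z w, A z (A z w) = -w) {v f : ℂ → E4} {z₀ : ℂ}
    (hA : ∃ W, MemContDiffHolder 1 r W ∧ W =ᶠ[𝓝 z₀] A)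
    (hv : ∃ W, MemContDiffHolder 1 r W ∧ W =ᶠ[𝓝 z₀] v)
    (hf : ∃ W, MemContDiffHolder 1 r W ∧ W =ᶠ[𝓝 z₀] f)
    (heq : ∀ᶠ z in 𝓝 z₀, fderiv ℝ v z 1 + A z (fderiv ℝ v z I) = f z) :
    ∃ W, MemContDiffHolder 2 r W ∧ W =ᶠ[𝓝 z₀] v := by
  have hr1' : r ≤ 1 := hr1.le
  have hs0 : 0 < (r : ℝ) := hr
  obtain ⟨A', hA', hA'A⟩ := hA
  obtain ⟨V, hV, hVv⟩ := hv
  obtain ⟨F, hF, hFf⟩ := hf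
  have hVd : Differentiable ℝ V := hV.contDiff.differentiable (by simp)
  have hFd : Differentiable ℝ F := hF.contDiff.differentiable (by simp)
  have hAd : Differentiable ℝ A' := hA'.contDiff.differentiable (by simp)
  -- a disc on which everything holds, and the equation for the members
  obtain ⟨ρ₀, hρ₀, hball⟩ :=
    Metric.eventually_nhds_iff_ball.1 (hA'A.and (hVv.eventuallyEq_nhds.and (hFf.and heq)))
  have heq' : ∀ z ∈ ball z₀ ρ₀, fderiv ℝ V z 1 + A' z (fderiv ℝ V z I) = F z := by
    intro z hz
    obtain ⟨h1, h2, h3, h4⟩ := hball z hz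
    rw [h2.fderiv_eq, h1, h3]
    exact h4
  -- the frame and the linear estimate
  obtain ⟨δ, N, Θ, Θi, hδ, hδρ, hN, hΘs, hΘ₀, hΘ₁, hΘ₂, hΘis, hΘi₀, hΘi₁, hA'₀, hA'₁, hinv₁, hinv₂,
    hAΘ⟩ := exists_linearCR_frame hr1' hρ₀ hA2 hA' fun z hz => (hball z hz).1
  obtain ⟨K, hK0, hK⟩ := holder_fderiv_of_linearCR hr hr1 hT hδ hN hΘs hΘ₀ hΘ₁ hΘ₂ hΘis hΘi₀
    hΘi₁ hA'₀ hA'₁ hinv₁ hinv₂ hAΘ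
  -- bounds for the members
  obtain ⟨a, ha, -, haV₁, haV₂, -⟩ := bounds_of_memContDiffHolder_one hr1' hV
  obtain ⟨b, hb, -, hbF₁, hbF₂, -⟩ := bounds_of_memContDiffHolder_one hr1' hF
  obtain ⟨c, hc, -, hcA₁, hcA₂, -⟩ := bounds_of_memContDiffHolder_one hr1' hA'
  set m : ℝ := a + b + c with hm
  set M : ℝ := m + 2 * m ^ 2 with hM
  have hm0 : 0 ≤ m := by positivity
  have hM0 : 0 ≤ M := by positivity
  have haM : a ≤ M := by rw [hM, hm]; nlinarith
  have hfM₀ : b + c * a ≤ M := by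
    rw [hM, hm]; nlinarith [mul_nonneg hc ha, mul_nonneg ha hb, mul_nonneg hb hc]
  have hfM₁ : b + (c * a + c * a) ≤ M := by
    rw [hM, hm]; nlinarith [mul_nonneg hc ha, mul_nonneg ha hb, mul_nonneg hb hc]
  have hd0 : ∀ z z' : ℂ, 0 ≤ ‖z - z'‖ ^ (r : ℝ) := fun z z' => Real.rpow_nonneg (norm_nonneg _) _
  -- the uniform `C^{1,r}` bound for the difference quotients
  have key : ∀ e : ℂ, ‖e‖ = 1 → ∀ h : ℝ, h ≠ 0 → |h| < ρ₀ / 2 →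
      (∀ z ∈ ball z₀ (δ / 2), ‖fderiv ℝ (fun x => h⁻¹ • (V (x + h • e) - V x)) z‖ ≤ K * M) ∧
      ∀ z ∈ ball z₀ (δ / 2), ∀ z' ∈ ball z₀ (δ / 2),
        ‖fderiv ℝ (fun x => h⁻¹ • (V (x + h • e) - V x)) z -
          fderiv ℝ (fun x => h⁻¹ • (V (x + h • e) - V x)) z'‖ ≤ K * M * ‖z - z'‖ ^ (r : ℝ) := by
    intro e he h hh hhρ
    have hvh : ContDiff ℝ 1 fun x => h⁻¹ • (V (x + h • e) - V x) :=
      ((hV.contDiff.comp (contDiff_id.add contDiff_const)).sub hV.contDiff).const_smul _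
    -- the equation on `B(z₀, δ)`
    have heqh : ∀ z ∈ ball z₀ δ, fderiv ℝ (fun x => h⁻¹ • (V (x + h • e) - V x)) z 1 +
        A' z (fderiv ℝ (fun x => h⁻¹ • (V (x + h • e) - V x)) z I) =
        h⁻¹ • (F (z + h • e) - F z) -
          (h⁻¹ • (A' (z + h • e) - A' z)) (fderiv ℝ V (z + h • e) I) := by
      intro z hz
      have hz' := mem_ball_iff_norm.1 hz
      have hz₁ : z ∈ ball z₀ ρ₀ := mem_ball_iff_norm.2 (by linarith)
      have hz₂ : z + h • e ∈ ball z₀ ρ₀ := by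
        rw [mem_ball_iff_norm]
        calc ‖z + h • e - z₀‖ = ‖(z - z₀) + h • e‖ := by ring_nf
          _ ≤ ‖z - z₀‖ + ‖h • e‖ := norm_add_le _ _
          _ < δ + |h| := by rw [norm_smul, Real.norm_eq_abs, he, mul_one]; linarith
          _ < ρ₀ := by linarith
      exact diffQuot_equation hVd (heq' z hz₁) (heq' _ hz₂)
    -- the bounds
    have hv₀ : ∀ z, ‖h⁻¹ • (V (z + h • e) - V z)‖ ≤ M := fun z =>
      (norm_diffQuot_le hVd haV₁ hh e z).trans (by rw [he, mul_one]; exact haM)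
    have hv₁ : ∀ z z', ‖h⁻¹ • (V (z + h • e) - V z) - h⁻¹ • (V (z' + h • e) - V z')‖ ≤
        M * ‖z - z'‖ ^ (r : ℝ) := fun z z' =>
      (norm_diffQuot_sub_diffQuot_le hVd haV₂ hh e z z').trans
        (by rw [he, mul_one]; exact mul_le_mul_of_nonneg_right haM (hd0 z z'))
    have hq₀ : ∀ z, ‖h⁻¹ • (F (z + h • e) - F z)‖ ≤ b := fun z =>
      (norm_diffQuot_le hFd hbF₁ hh e z).trans (by rw [he, mul_one])
    have hq₁ : ∀ z z', ‖h⁻¹ • (F (z + h • e) - F z) - h⁻¹ • (F (z' + h • e) - F z')‖ ≤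
        b * ‖z - z'‖ ^ (r : ℝ) := fun z z' =>
      (norm_diffQuot_sub_diffQuot_le hFd hbF₂ hh e z z').trans (by rw [he, mul_one])
    have hp₀ : ∀ z, ‖h⁻¹ • (A' (z + h • e) - A' z)‖ ≤ c := fun z =>
      (norm_diffQuot_le hAd hcA₁ hh e z).trans (by rw [he, mul_one])
    have hp₁ : ∀ z z', ‖h⁻¹ • (A' (z + h • e) - A' z) - h⁻¹ • (A' (z' + h • e) - A' z')‖ ≤
        c * ‖z - z'‖ ^ (r : ℝ) := fun z z' =>
      (norm_diffQuot_sub_diffQuot_le hAd hcA₂ hh e z z').trans (by rw [he, mul_one])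
    have hI : ‖(I : ℂ)‖ = 1 := by simp
    have hw₀ : ∀ z, ‖fderiv ℝ V (z + h • e) I‖ ≤ a := fun z =>
      ((fderiv ℝ V (z + h • e)).le_opNorm I).trans (by rw [hI, mul_one]; exact haV₁ _)
    have hw₁ : ∀ z z', ‖fderiv ℝ V (z + h • e) I - fderiv ℝ V (z' + h • e) I‖ ≤
        a * ‖z - z'‖ ^ (r : ℝ) := fun z z' => by
      change ‖(fderiv ℝ V (z + h • e) - fderiv ℝ V (z' + h • e)) I‖ ≤ _
      refine ((fderiv ℝ V (z + h • e) - fderiv ℝ V (z' + h • e)).le_opNorm I).trans ?_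
      rw [hI, mul_one]
      exact (haV₂ _ _).trans_eq (by rw [add_sub_add_right_eq_sub])
    obtain ⟨h1₀, h1₁⟩ := holder_bound_clm_apply hp₀ hp₁ hw₀ hw₁
    obtain ⟨h2₀, h2₁⟩ := holder_bound_sub hq₀ hq₁ h1₀ h1₁
    exact hK _ _ M hM0 hvh heqh hv₀ hv₁ (fun z => (h2₀ z).trans hfM₀)
      fun z z' => (h2₁ z z').trans (mul_le_mul_of_nonneg_right hfM₁ (hd0 z z'))
  -- a sequence `hₙ → 0` in `(0, ρ₀ / 2)`
  obtain ⟨hs, -, hsI, hs0'⟩ := exists_seq_strictAnti_tendsto' (show (0 : ℝ) < ρ₀ / 2 by positivity)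
  have hsne : ∀ n, hs n ≠ 0 := fun n => (hsI n).1.ne'
  have hsabs : ∀ n, |hs n| < ρ₀ / 2 := fun n => by rw [abs_of_pos (hsI n).1]; exact (hsI n).2
  -- the partial derivatives of `V` are of local class `C^{1,r}`
  have hdir : ∀ e : ℂ, ‖e‖ = 1 →
      ∃ W, MemContDiffHolder 1 r W ∧ W =ᶠ[𝓝 z₀] fun z => fderiv ℝ V z e := by
    intro e he
    have hε : Tendsto (fun n => a * (|hs n| * ‖e‖) ^ (r : ℝ) * ‖e‖) atTop (𝓝 0) := by
      have h1 : Tendsto (fun n => |hs n| * ‖e‖) atTop (𝓝 0) := by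
        have h := ((continuous_abs.tendsto (0 : ℝ)).comp hs0').mul_const ‖e‖
        simpa using h
      have h2 := ((h1.rpow_const_nhds_zero hs0).const_mul a).mul_const ‖e‖
      simpa using h2
    have hvc : ∀ t : ℝ, ContDiff ℝ 1 fun x => t⁻¹ • (V (x + t • e) - V x) := fun t =>
      ((hV.contDiff.comp (contDiff_id.add contDiff_const)).sub hV.contDiff).const_smul _
    obtain ⟨hwd, hw₀, hw₁⟩ := differentiableAt_of_holder_approx
      (v := fun n z => (hs n)⁻¹ • (V (z + hs n • e) - V z)) (w := fun z => fderiv ℝ V z e)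
      (half_pos hδ) hs0 (fun n => (hvc (hs n)).differentiable (by simp))
      (fun n z => norm_diffQuot_sub_fderiv_le hVd hs0.le haV₂ (hsne n) e z) hε
      (fun n => (key e he (hs n) (hsne n) (hsabs n)).1)
      (fun n => (key e he (hs n) (hsne n) (hsabs n)).2)
    have hKM : K * M ≤ max a (K * M) := le_max_right _ _
    refine locHolder_one_of_bounds (ρ := δ / 2 / 2) (b := max a (K * M)) (by positivity) hr hr1'
      hwd (fun z _ => ?_) (fun z hz => (hw₀ z hz).trans hKM)
      fun z hz z' hz' => (hw₁ z hz z' hz').trans (mul_le_mul_of_nonneg_right hKM (hd0 z z'))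
    exact (((fderiv ℝ V z).le_opNorm e).trans (by rw [he, mul_one]; exact haV₁ z)).trans
      (le_max_left _ _)
  -- assembling the two partial derivatives
  obtain ⟨W, hW, hWV⟩ := locHolder_succ_of_fderiv hr1' (k := 1) (Eventually.of_forall fun z => hVd z)
    ⟨V, hV, EventuallyEq.rfl⟩ (hdir 1 (by simp)) (hdir I (by simp))
  exact ⟨W, hW, hWV.trans hVv⟩

/-- The derivative of a partial derivative is the second derivative:
`D(x ↦ Dv(x) e')(z) e = D²v(z) e e'`. [folklore] -/
theorem fderiv_fderiv_apply {Y : Type*} [NormedAddCommGroup Y] [NormedSpace ℝ Y] {v : ℂ → Y}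
    {z : ℂ} (hv : DifferentiableAt ℝ (fderiv ℝ v) z) (e e' : ℂ) :
    fderiv ℝ (fun x => fderiv ℝ v x e') z e = fderiv ℝ (fderiv ℝ v) z e e' := by
  rw [fderiv_clm_apply hv (differentiableAt_const e'), fderiv_const_apply]
  simp [ContinuousLinearMap.flip_apply]

/-- **Differentiating the equation.** If `v` is `C²` near `z₀`, `A` is differentiable near `z₀`
and `∂ₓ v + A ∂_y v = f` near `z₀`, then `w = ∂_e v` solves near `z₀` the same system with
right-hand side `∂_e f - (∂_e A) (∂_y v)` (symmetry of second derivatives). [folklore] -/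
theorem linearCR_fderiv_apply {A : ℂ → E4 →L[ℝ] E4} {v f : ℂ → E4} {z₀ : ℂ} (e : ℂ)
    (hv : ∀ᶠ z in 𝓝 z₀, ContDiffAt ℝ 2 v z) (hA : ∀ᶠ z in 𝓝 z₀, DifferentiableAt ℝ A z)
    (heq : ∀ᶠ z in 𝓝 z₀, fderiv ℝ v z 1 + A z (fderiv ℝ v z I) = f z) :
    ∀ᶠ z in 𝓝 z₀, fderiv ℝ (fun x => fderiv ℝ v x e) z 1 +
        A z (fderiv ℝ (fun x => fderiv ℝ v x e) z I) =
      fderiv ℝ f z e - fderiv ℝ A z e (fderiv ℝ v z I) := by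
  have heq' : (fun z => fderiv ℝ v z 1 + A z (fderiv ℝ v z I)) =ᶠ[𝓝 z₀] f := heq
  filter_upwards [hv, hA, heq'.eventuallyEq_nhds] with z hvz hAz heqz
  have hD : DifferentiableAt ℝ (fderiv ℝ v) z :=
    (hvz.fderiv_right (m := 1) (by norm_num)).differentiableAt (by simp)
  have hsymm : IsSymmSndFDerivAt ℝ v z :=
    hvz.isSymmSndFDerivAt (by simp [minSmoothness_of_isRCLikeNormedField])
  have h1 : DifferentiableAt ℝ (fun x => fderiv ℝ v x 1) z := hD.clm_apply (differentiableAt_const _)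
  have hI : DifferentiableAt ℝ (fun x => fderiv ℝ v x I) z := hD.clm_apply (differentiableAt_const _)
  -- differentiate the equation at `z` in the direction `e`
  have hdiff := heqz.fderiv_eq (𝕜 := ℝ)
  rw [fderiv_fun_add h1 (hAz.clm_apply hI), fderiv_clm_apply hAz hI] at hdiff
  have hde := DFunLike.congr_fun hdiff e
  simp only [add_apply, ContinuousLinearMap.coe_comp, Function.comp_apply,
    ContinuousLinearMap.flip_apply, fderiv_fderiv_apply hD] at hde
  -- use the symmetry of the second derivative
  rw [fderiv_fderiv_apply hD, fderiv_fderiv_apply hD, hsymm 1 e, hsymm I e, ← hde]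
  abel

/-- **The bootstrapping induction for the linear system.** Let `0 < r < 1`, assume the `C^{1,r}`
estimate for the Cauchy transform on `ℂ²`-valued densities, and let `A(z)` be linear complex
structures on `ℝ⁴`. If `A` and `f` are of local class `C^{k+1,r}` near `z₀`, `v` is of local class
`C^{1,r}` near `z₀` and `∂ₓ v + A ∂_y v = f` near `z₀`, then `v` is of local class `C^{k+2,r}` near
`z₀`. [cite: McDuffSalamon2012, Thm B.4.1] -/
theorem locHolder_succ_of_linearCR {r : ℝ≥0} (hr : 0 < r) (hr1 : r < 1)
    (hT : CauchyTransformHolderApriori (ℂ × ℂ) r) {A : ℂ → E4 →L[ℝ] E4}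
    (hA2 : ∀ z w, A z (A z w) = -w) {z₀ : ℂ} (k : ℕ) :
    ∀ v f : ℂ → E4, (∃ W, MemContDiffHolder (k + 1) r W ∧ W =ᶠ[𝓝 z₀] A) →
      (∃ W, MemContDiffHolder 1 r W ∧ W =ᶠ[𝓝 z₀] v) →
      (∃ W, MemContDiffHolder (k + 1) r W ∧ W =ᶠ[𝓝 z₀] f) →
      (∀ᶠ z in 𝓝 z₀, fderiv ℝ v z 1 + A z (fderiv ℝ v z I) = f z) →
      ∃ W, MemContDiffHolder (k + 2) r W ∧ W =ᶠ[𝓝 z₀] v := by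
  have hr1' : r ≤ 1 := hr1.le
  induction k with
  | zero =>
    intro v f hA hv hf heq
    exact locHolder_two_of_linearCR hr hr1 hT hA2 hA hv hf heq
  | succ k ih =>
    intro v f hA hv hf heq
    have hA' := locHolder_of_succ hr1' hA
    have hf' := locHolder_of_succ hr1' hf
    have hv2 : ∃ W, MemContDiffHolder (k + 2) r W ∧ W =ᶠ[𝓝 z₀] v := ih v f hA' hv hf' heq
    have hvC : ∀ᶠ z in 𝓝 z₀, ContDiffAt ℝ 2 v z := by
      filter_upwards [eventually_contDiffAt_of_locHolder hv2] with z hz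
      exact hz.of_le (by exact_mod_cast Nat.le_add_left 2 k)
    have hAd : ∀ᶠ z in 𝓝 z₀, DifferentiableAt ℝ A z := by
      filter_upwards [eventually_contDiffAt_of_locHolder hA] with z hz
      exact hz.differentiableAt (by simp)
    -- the partial derivatives of `v` are of local class `C^{k+2,r}`
    have hdir : ∀ e : ℂ, ∃ W, MemContDiffHolder (k + 2) r W ∧
        W =ᶠ[𝓝 z₀] fun z => fderiv ℝ v z e := by
      intro e
      refine ih (fun z => fderiv ℝ v z e)
        (fun z => fderiv ℝ f z e - fderiv ℝ A z e (fderiv ℝ v z I)) hA' ?_ ?_ ?_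
      · exact locHolder_of_le hr1' (Nat.le_add_left 1 k) (locHolder_fderiv_apply hv2 e)
      · exact locHolder_sub (locHolder_fderiv_apply hf e)
          (locHolder_clm_apply hr1' (locHolder_fderiv_apply hA e) (locHolder_fderiv_apply hv2 I))
      · exact linearCR_fderiv_apply e hvC hAd heq
    have hvd : ∀ᶠ z in 𝓝 z₀, DifferentiableAt ℝ v z := by
      filter_upwards [hvC] with z hz
      exact hz.differentiableAt (by simp)
    exact locHolder_succ_of_fderiv hr1' hvd hv2 (hdir 1) (hdir I)

/-- **Elliptic regularity for `J`-holomorphic curves (Hölder bootstrapping).** Let `J` be a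
`C^∞` almost complex structure on `ℝ⁴` (`J_x² = -1`), and `u : ℂ → ℝ⁴` a `C¹` map, flat
`J`-holomorphic (`du(i ζ) = J(u) du(ζ)`), whose derivative is locally `r`-Hölder (`0 < r < 1`).
Assuming the `C^{1,r}` estimate for the Cauchy transform on `ℂ²`-valued densities, `u` is `C^∞`:
`∂ₓ u + J(u) ∂_y u = 0` is a first-order elliptic system whose coefficients have the local Hölder
class of `u`, and each round of the bootstrapping `locHolder_succ_of_linearCR` raises that class
by one. [cite: McDuffSalamon2012, Thm B.4.1] -/
theorem contDiff_of_isJHolomorphicFlat_of_holder {r : ℝ≥0} (hr : 0 < r) (hr1 : r < 1)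
    (hT : Literature.Analysis.Complex.CauchyTransformHolderApriori (ℂ × ℂ) r)
    (J : EuclideanSpace ℝ (Fin 4) → EuclideanSpace ℝ (Fin 4) →L[ℝ] EuclideanSpace ℝ (Fin 4))
    (hJs : ContDiff ℝ ∞ J) (hJ2 : ∀ x v, J x (J x v) = -v)
    (u : ℂ → EuclideanSpace ℝ (Fin 4)) (hu : ContDiff ℝ 1 u) (huJ : IsJHolomorphicFlat J u)
    (hH : ∀ z₀ : ℂ, ∃ C ρ : ℝ, 0 < ρ ∧ ∀ z ∈ Metric.ball z₀ ρ, ∀ z' ∈ Metric.ball z₀ ρ,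
      ‖fderiv ℝ u z - fderiv ℝ u z'‖ ≤ C * ‖z - z'‖ ^ (r : ℝ)) :
    ContDiff ℝ ∞ u := by
  have hr1' : r ≤ 1 := hr1.le
  -- the coefficients `A = J ∘ u` and the equation `∂ₓ u + A ∂_y u = 0`
  set A : ℂ → E4 →L[ℝ] E4 := fun z => J (u z) with hA
  have hA2 : ∀ z w, A z (A z w) = -w := fun z w => hJ2 _ _
  have heq : ∀ z, fderiv ℝ u z 1 + A z (fderiv ℝ u z I) = 0 := by
    intro z
    have h1 := huJ z 1
    rw [mul_one] at h1
    change fderiv ℝ u z 1 + J (u z) (fderiv ℝ u z I) = 0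
    rw [h1, hJ2, add_neg_cancel]
  -- bootstrapping: `u` is of local class `C^{k+1,r}` near every point, for every `k`
  have hloc : ∀ (k : ℕ) (z₀ : ℂ), ∃ W, MemContDiffHolder (k + 1) r W ∧ W =ᶠ[𝓝 z₀] u := by
    intro k
    induction k with
    | zero => exact fun z₀ => locHolder_one_of_holder_fderiv hr hr1' hu hH z₀
    | succ k ih =>
      intro z₀
      have hAk : ∃ W, MemContDiffHolder (k + 1) r W ∧ W =ᶠ[𝓝 z₀] A :=
        locHolder_comp_left hr1' hJs (ih z₀)
      have hu1 : ∃ W, MemContDiffHolder 1 r W ∧ W =ᶠ[𝓝 z₀] u :=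
        locHolder_of_le hr1' (Nat.le_add_left 1 k) (ih z₀)
      exact locHolder_succ_of_linearCR hr hr1 hT hA2 k u (fun _ => 0) hAk hu1 (locHolder_zero _)
        (Eventually.of_forall heq)
  -- smoothness
  rw [contDiff_infty]
  intro n
  rw [contDiff_iff_contDiffAt]
  intro z₀
  have h := (eventually_contDiffAt_of_locHolder (hloc n z₀)).self_of_nhds
  exact h.of_le (by exact_mod_cast Nat.le_succ n)

end Literature.Geometry.Symplectic
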